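import Summits.SmoothPoincare4.SmoothPoincare4.Theorems.ShadowApproximation.Negative.LevelSymmetriesFalse

/-!
# `ShadowApproximation` — negative-side support IV: the unit-twist tower ("units never die")

Support file for the crux `CongruenceShadows.ShadowApproximation` (stmt-SmoothPoincare4-14595),
standing disprover's `Cruxes/ShadowApproximation/Disproof.lean` §8 (gen 3), continuing
`Negative/UnitTwist.lean` / `Negative/LevelSymmetriesFalse.lean` (gen 2: the unit twist `δ` is a
symmetry of the level-`M₅` shadow triple of `N = s4Kernels` not congruent mod `M₅` to any symmetry
of `(N₀,N₁)`). Is that a shallow-level artefact? NO — units never die: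
* `deltaT t t'` : the family `δ(t,t') = τ_aᵗ τ_b^{-t'} τ_a^{t-1} τ_b τ_a⁻¹ ∈ Aut S₃` (handle `0`,
  matrix `[[t(1-N), N], [-N, t']]`, `N = tt'-1`; gen 2's `delta = δ(3,2)`), via `zpow` in `MulAut S₃`;
* mechanism `map_deltaT_a0_of_a0` / `_b0_of_b0` / `_b0_of_a0`: mod `a₀`, `δ a₀ ≡ b₀^{-N}`; mod
  `b₀`, `δ b₀ ≡ a₀^{N}`; mod `a₀` the survivor `b₀` is multiplied by the unit `t'`;
* `deltaT_level` : `δ(t,t')(Nᵢ ⊔ M) = Nᵢ ⊔ M` for EVERY characteristic finite-index `M ∋` all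
  `n`-th powers, `n ∣ tt'-1`; `not_lift_deltaT` : no automorphism stabilising `N₀, N₁` is
  congruent to `δ(t,t')` mod `M ≤ ker χ_q` when `t' ≢ ±1 (mod q)` (`chiQ_alpha_b0`: `±1` on the pair
  quotient `S₃ ⧸ N₀N₁ ≅ ℤ`, any modulus `q`);
* `unit_twist_tower` : `δ(3,2)` is a non-liftable level symmetry at every characteristic f.i. `M`
  with `S₃⁵ ⊆ M ⊆ M₅` (the whole lower exponent-5 central series, unbounded class);
* `levelSymmetriesLift_fails_cofinally` : below EVERY characteristic f.i. `M₀` the level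
  `M₀ ⊓ M₅` carries a non-liftable `δ(t,t')` (`n = [S₃ : M₀ ⊓ M₅]`, `t' = (ordCompl[5] n)⁴ + 1`);
  `not_eventualLevelSymmetriesLift` : the "eventual" strengthening of LevelSymmetriesLift is FALSE.
So a proof of the crux must renormalise the unit scalars of the `ψ_M` at every level, coherently
(three `(ℤ/n)ˣ/±1`-torsors), and by compactness the pro-stabiliser of `(N̂₀,N̂₁,N̂₂)` in the
congruence completion strictly exceeds `cl(Stab N₀ ∩ Stab N₁ ∩ Stab N₂)` ("CONG" fails for the
triple). Imports `Negative/LevelSymmetriesFalse.lean` (pair-quotient `±1` lemma, `M₅`, twists);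
`chiQ` generalises its `χ` to any modulus.
-/

noncomputable section

namespace Summit.SmoothPoincare4.SmoothPoincare4.Theorems.ShadowApproximation.Negative

set_option linter.dupNamespace false

open Literature.Topology.FourManifolds
open Summit.SmoothPoincare4.SmoothPoincare4.Theses.CongruenceShadows
open SurfaceGroup

/-- The character `χ_q = χ_{b₀} : S₃ → ℤ/q` (`b₀ ↦ 1`, every other generator `↦ 0`), any modulus
`q`. [folklore] -/
def chiQGen (q : ℕ) (p : surfaceGen 3) : Multiplicative (ZMod q) :=
  if p = ((0 : Fin 3), true) then Multiplicative.ofAdd 1 else 1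

/-- `χ_q` as a hom. [folklore] -/
def chiQ (q : ℕ) : S →* Multiplicative (ZMod q) := SurfaceGroup.toCommGroup (chiQGen q)

/-- `χ_q (b₀) = 1`. [folklore] -/
theorem chiQ_b0 (q : ℕ) : chiQ q (b 0) = Multiplicative.ofAdd 1 := by simp [chiQ, chiQGen]

/-- `χ_q` kills `N₀` and `N₁`. [folklore] -/
theorem N01_le_ker_chiQ (q : ℕ) : s4Kernels 0 ⊔ s4Kernels 1 ≤ (chiQ q).ker := by
  refine sup_le ?_ ?_
  all_goals
    rw [s4Kernels_eq]
    refine Subgroup.normalClosure_le_normal ?_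
    rintro _ ⟨p, hp, rfl⟩
    rw [SetLike.mem_coe, MonoidHom.mem_ker, chiQ, SurfaceGroup.toCommGroup_of]
    obtain ⟨i, c⟩ := p
    have hp' : ((i, c) : surfaceGen 3) ∈ (s4Gens _ : Finset _) := hp
    fin_cases i <;> cases c <;> first | exact absurd hp' (by decide) | simp [chiQGen]

/-- **`±1` on the pair quotient.** An automorphism stabilising `N₀` and `N₁` multiplies `b₀` by `±1`
modulo `N₀ ⊔ N₁`, hence `χ_q(α b₀) = ±χ_q(b₀)` for every modulus `q`. [folklore] -/
theorem chiQ_alpha_b0 (q : ℕ) (α : S ≃* S) (h0 : (s4Kernels 0).map α.toMonoidHom = s4Kernels 0)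
    (h1 : (s4Kernels 1).map α.toMonoidHom = s4Kernels 1) :
    chiQ q (α (b 0)) = Multiplicative.ofAdd 1 ∨ chiQ q (α (b 0)) = (Multiplicative.ofAdd 1)⁻¹ := by
  set P : Subgroup S := s4Kernels 0 ⊔ s4Kernels 1 with hPdef
  have hP : P.map (α : S →* S) = P := by
    have : P.map α.toMonoidHom = P := by rw [hPdef, Subgroup.map_sup, h0, h1]
    simpa using this
  obtain ⟨e⟩ := isFreeOfRank_quotient_N01
  obtain ⟨k, hk, hβ⟩ := mulEquiv_infinite_cyclic e (QuotientGroup.congr P P α hP)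
  have h2 : (QuotientGroup.mk (α (b 0)) : S ⧸ P) = QuotientGroup.mk (b 0 ^ k) := by
    rw [← QuotientGroup.congr_mk P P α hP, hβ, QuotientGroup.mk_zpow]
  rw [QuotientGroup.eq] at h2
  have h3 : chiQ q ((α (b 0))⁻¹ * b 0 ^ k) = 1 := N01_le_ker_chiQ q h2
  rw [map_mul, map_inv, map_zpow, inv_mul_eq_one, chiQ_b0] at h3
  rcases hk with rfl | rfl
  · exact Or.inl (by rw [h3, zpow_one])
  · exact Or.inr (by rw [h3, zpow_neg_one])

/-- `τ_a` as an element of the automorphism GROUP `MulAut S₃`. [folklore] -/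
abbrev tA : MulAut S := twA

/-- `τ_b` as an element of `MulAut S₃`. [folklore] -/
abbrev tB : MulAut S := twB

/-- `τ_aᵏ a₀ = a₀`. [folklore] -/
theorem tA_zpow_a0 (k : ℤ) : (tA ^ k) (a 0) = a 0 := by
  induction k using Int.induction_on with
  | zero => simp
  | succ n ih => rw [zpow_add_one, MulAut.mul_apply, twA_a0, ih]
  | pred n ih => rw [zpow_sub_one, MulAut.mul_apply, MulAut.inv_def, twA_symm_a0, ih]

/-- `τ_aᵏ b₀ = b₀ a₀ᵏ`. [folklore] -/
theorem tA_zpow_b0 (k : ℤ) : (tA ^ k) (b 0) = b 0 * a 0 ^ k := by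
  induction k using Int.induction_on with
  | zero => simp
  | succ n ih =>
    rw [zpow_add_one, MulAut.mul_apply, twA_b0, map_mul, ih, tA_zpow_a0, mul_assoc, ← zpow_add_one]
  | pred n ih =>
    rw [zpow_sub_one, MulAut.mul_apply, MulAut.inv_def, twA_symm_b0, map_mul, map_inv, ih,
      tA_zpow_a0, mul_assoc, ← zpow_sub_one]

/-- `τ_aᵏ` fixes the generators of handles `1, 2`. [folklore] -/
theorem tA_zpow_of (k : ℤ) {p : surfaceGen 3} (hp : p.1 ≠ 0) :
    (tA ^ k) (PresentedGroup.of p) = PresentedGroup.of p := by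
  induction k using Int.induction_on with
  | zero => simp
  | succ n ih => rw [zpow_add_one, MulAut.mul_apply, twA_of hp, ih]
  | pred n ih => rw [zpow_sub_one, MulAut.mul_apply, MulAut.inv_def, twA_symm_of hp, ih]

/-- `τ_bᵏ b₀ = b₀`. [folklore] -/
theorem tB_zpow_b0 (k : ℤ) : (tB ^ k) (b 0) = b 0 := by
  induction k using Int.induction_on with
  | zero => simp
  | succ n ih => rw [zpow_add_one, MulAut.mul_apply, twB_b0, ih]
  | pred n ih => rw [zpow_sub_one, MulAut.mul_apply, MulAut.inv_def, twB_symm_b0, ih]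

/-- `τ_bᵏ a₀ = a₀ b₀ᵏ`. [folklore] -/
theorem tB_zpow_a0 (k : ℤ) : (tB ^ k) (a 0) = a 0 * b 0 ^ k := by
  induction k using Int.induction_on with
  | zero => simp
  | succ n ih =>
    rw [zpow_add_one, MulAut.mul_apply, twB_a0, map_mul, ih, tB_zpow_b0, mul_assoc, ← zpow_add_one]
  | pred n ih =>
    rw [zpow_sub_one, MulAut.mul_apply, MulAut.inv_def, twB_symm_a0, map_mul, map_inv, ih,
      tB_zpow_b0, mul_assoc, ← zpow_sub_one]

/-- `τ_bᵏ` fixes the generators of handles `1, 2`. [folklore] -/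
theorem tB_zpow_of (k : ℤ) {p : surfaceGen 3} (hp : p.1 ≠ 0) :
    (tB ^ k) (PresentedGroup.of p) = PresentedGroup.of p := by
  induction k using Int.induction_on with
  | zero => simp
  | succ n ih => rw [zpow_add_one, MulAut.mul_apply, twB_of hp, ih]
  | pred n ih => rw [zpow_sub_one, MulAut.mul_apply, MulAut.inv_def, twB_symm_of hp, ih]

/-- **The unit twist `δ(t,t') = τ_aᵗ ∘ τ_b^{-t'} ∘ τ_a^{t-1} ∘ τ_b ∘ τ_a⁻¹`** (rightmost first), on
`ℤ⟨a₀,b₀⟩` the matrix `[[t(1-N), N], [-N, t']]`, `N = tt'-1`; gen 2's `delta = δ(3,2)`. [folklore] -/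
def deltaT (t t' : ℤ) : MulAut S := tA ^ t * tB ^ (-t') * tA ^ (t - 1) * tB * tA⁻¹

/-- `δ(t,t')` unfolded. [folklore] -/
theorem deltaT_apply (t t' : ℤ) (x : S) :
    deltaT t t' x = (tA ^ t) ((tB ^ (-t')) ((tA ^ (t - 1)) (twB (twA.symm x)))) := by
  simp [deltaT, MulAut.inv_def]

/-- `δ(t,t')` fixes the generators of handles `1, 2`. [folklore] -/
theorem deltaT_of (t t' : ℤ) {p : surfaceGen 3} (hp : p.1 ≠ 0) :
    deltaT t t' (PresentedGroup.of p) = PresentedGroup.of p := by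
  rw [deltaT_apply, twA_symm_of hp, twB_of hp, tA_zpow_of _ hp, tB_zpow_of _ hp, tA_zpow_of _ hp]

/-- `δ(t,t') a₀` through any hom killing `a₀`: `f (δ a₀) = f(b₀)^{-(tt'-1)}`. [folklore] -/
theorem map_deltaT_a0_of_a0 {Q : Type*} [Group Q] (f : S →* Q) (t t' : ℤ) (ha : f (a 0) = 1) :
    f (deltaT t t' (a 0)) = f (b 0) ^ (-(t * t' - 1)) := by
  simp only [deltaT_apply, twA_symm_a0, twB_a0, map_mul, map_zpow, tA_zpow_a0, tA_zpow_b0,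
    tB_zpow_a0, tB_zpow_b0, ha, one_mul, mul_one, one_zpow]
  group

/-- `δ(t,t') b₀` through any hom killing `a₀`: `f (δ b₀) = f(b₀)^{t'}` — the unit scalar `t'` on
the survivor `b₀` of the pairs `(0,1)`. [folklore] -/
theorem map_deltaT_b0_of_a0 {Q : Type*} [Group Q] (f : S →* Q) (t t' : ℤ) (ha : f (a 0) = 1) :
    f (deltaT t t' (b 0)) = f (b 0) ^ t' := by
  simp only [deltaT_apply, twA_symm_b0, twB_a0, twB_b0, map_mul, map_inv, map_zpow, tA_zpow_a0,
    tA_zpow_b0, tB_zpow_a0, tB_zpow_b0, ha, one_mul, mul_one, one_zpow]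
  group

/-- `δ(t,t') b₀` through any hom killing `b₀`: `f (δ b₀) = f(a₀)^{tt'-1}`. [folklore] -/
theorem map_deltaT_b0_of_b0 {Q : Type*} [Group Q] (f : S →* Q) (t t' : ℤ) (hb : f (b 0) = 1) :
    f (deltaT t t' (b 0)) = f (a 0) ^ (t * t' - 1) := by
  simp only [deltaT_apply, twA_symm_b0, twB_a0, twB_b0, map_mul, map_inv, map_zpow, tA_zpow_a0,
    tA_zpow_b0, tB_zpow_a0, tB_zpow_b0, hb, one_mul]
  group

/-- The scalar of `δ(t,t')` on the survivor `b₀`: `χ(δ b₀) = t'·χ(b₀) = t'` for the character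
`χ_q = χ_{b₀} : S₃ → ℤ/q`. [folklore] -/
theorem chiQ_deltaT_b0 (q : ℕ) (t t' : ℤ) :
    chiQ q (deltaT t t' (b 0)) = Multiplicative.ofAdd ((t' : ZMod q)) := by
  rw [map_deltaT_b0_of_a0 (chiQ q) t t' (by simp [chiQ, chiQGen]), chiQ_b0, ← ofAdd_zsmul]
  simp

section level

variable {t t' : ℤ} {n : ℕ} (hn : (n : ℤ) ∣ t * t' - 1)
include hn

/-- The generators of `Nᵢ` go to `Nᵢ ⊔ P` under `δ(t,t')` for every normal `P` containing all
`n`-th powers, `n ∣ tt' - 1`. [folklore] -/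
theorem deltaT_of_mem_sup (P : Subgroup S) [P.Normal] (hP : ∀ x : S, x ^ n ∈ P) (i : Fin 3)
    (p : surfaceGen 3) (hp : p ∈ s4Gens i) :
    deltaT t t' (PresentedGroup.of p) ∈ s4Kernels i ⊔ P := by
  by_cases h0 : p.1 = 0
  · obtain ⟨j, c⟩ := p
    simp only at h0
    subst h0
    have hmem : (PresentedGroup.of ((0 : Fin 3), c) : S) ∈ s4Kernels i ⊔ P :=
      Subgroup.mem_sup_left (of_mem_s4Kernels i hp)
    rw [← QuotientGroup.eq_one_iff] at hmem ⊢
    have hpow : ∀ x : S, (QuotientGroup.mk' (s4Kernels i ⊔ P) x) ^ n = 1 := fun x => by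
      rw [← map_pow, QuotientGroup.mk'_apply, QuotientGroup.eq_one_iff]
      exact Subgroup.mem_sup_right (hP x)
    obtain ⟨k, hk⟩ := hn
    cases c
    · have h := map_deltaT_a0_of_a0 (QuotientGroup.mk' (s4Kernels i ⊔ P)) t t' hmem
      rw [hk, show -((n : ℤ) * k) = (n : ℤ) * (-k) by ring, zpow_mul, zpow_natCast, hpow,
        one_zpow] at h
      exact h
    · have h := map_deltaT_b0_of_b0 (QuotientGroup.mk' (s4Kernels i ⊔ P)) t t' hmem
      rw [hk, zpow_mul, zpow_natCast, hpow, one_zpow] at h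
      exact h
  · rw [deltaT_of t t' h0]
    exact Subgroup.mem_sup_left (of_mem_s4Kernels i hp)

/-- `δ(t,t')` maps `Nᵢ ⊔ M` into itself for every characteristic `M` containing all `n`-th powers,
`n ∣ tt' - 1`. [folklore] -/
theorem deltaT_map_le (M : Subgroup S) [hM : M.Characteristic] (hMn : ∀ x : S, x ^ n ∈ M)
    (i : Fin 3) :
    (s4Kernels i ⊔ M).map (MulEquiv.toMonoidHom (deltaT t t')) ≤ s4Kernels i ⊔ M := by
  rw [Subgroup.map_sup, (Subgroup.characteristic_iff_map_eq.1 hM) (deltaT t t')]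
  refine sup_le ?_ le_sup_right
  rw [s4Kernels_eq i, Subgroup.map_normalClosure _ _ (deltaT t t').surjective]
  refine Subgroup.normalClosure_le_normal ?_
  rintro _ ⟨_, ⟨p, hp, rfl⟩, rfl⟩
  rw [← s4Kernels_eq i]
  exact deltaT_of_mem_sup hn M hMn i p hp

/-- **`δ(t,t')` is a symmetry of all three level-`M` shadows**, `δ(Nᵢ ⊔ M) = Nᵢ ⊔ M`, for EVERY
characteristic finite-index `M` containing the `n`-th powers, `n ∣ tt' - 1` (index count). [folklore] -/
theorem deltaT_level (M : Subgroup S) [M.Characteristic] [M.FiniteIndex] (hMn : ∀ x : S, x ^ n ∈ M)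
    (i : Fin 3) :
    (s4Kernels i ⊔ M).map (MulEquiv.toMonoidHom (deltaT t t')) = s4Kernels i ⊔ M := by
  set P : Subgroup S := s4Kernels i ⊔ M
  have hle : P.map (MulEquiv.toMonoidHom (deltaT t t')) ≤ P := deltaT_map_le hn M hMn i
  haveI : P.FiniteIndex := Subgroup.finiteIndex_of_le (le_sup_right : M ≤ P)
  have hidx : (P.map (MulEquiv.toMonoidHom (deltaT t t'))).index = P.index :=
    Subgroup.index_map_eq _ (deltaT t t').surjective (fun x hx => by
      rw [MonoidHom.mem_ker, MulEquiv.coe_toMonoidHom, map_eq_one_iff _ (deltaT t t').injective] at hx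
      rw [hx]
      exact one_mem _)
  refine le_antisymm hle (Subgroup.relIndex_eq_one.1 ?_)
  have h1 := Subgroup.relIndex_mul_index hle
  rw [hidx] at h1
  exact Nat.eq_of_mul_eq_mul_right (Nat.pos_of_ne_zero Subgroup.index_ne_zero_of_finite)
    (h1.trans (one_mul _).symm)

end level

/-- **`δ(t,t')` does not lift** when `t' ≢ ±1 (mod q)`: no automorphism stabilising `N₀` and `N₁`
is congruent to `δ(t,t')` modulo any `M ≤ ker χ_q` (e.g. `q = 5`, any `M ≤ M₅`): such an `α`
multiplies `b₀` by `±1` on the pair quotient `S ⧸ N₀N₁ ≅ ℤ` (`chiQ_alpha_b0`), `δ(t,t')` by `t'`.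
[folklore] -/
theorem not_lift_deltaT (q : ℕ) (t t' : ℤ) (ht1 : (t' : ZMod q) ≠ 1) (ht2 : (t' : ZMod q) ≠ -1)
    (M : Subgroup S) (hM : M ≤ (chiQ q).ker) :
    ¬ ∃ α : S ≃* S, (s4Kernels 0).map α.toMonoidHom = s4Kernels 0 ∧
      (s4Kernels 1).map α.toMonoidHom = s4Kernels 1 ∧ ∀ s, deltaT t t' s * (α s)⁻¹ ∈ M := by
  rintro ⟨α, h0, h1, hc⟩
  have hk : chiQ q (deltaT t t' (b 0) * (α (b 0))⁻¹) = 1 := hM (hc (b 0))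
  rw [map_mul, map_inv, mul_inv_eq_one, chiQ_deltaT_b0] at hk
  rcases chiQ_alpha_b0 q α h0 h1 with h | h <;> rw [h] at hk
  · exact ht1 (by simpa using congrArg Multiplicative.toAdd hk)
  · exact ht2 (by simpa using congrArg Multiplicative.toAdd hk)

/-- **Units never die (I): the exponent-5 tower.** At every characteristic finite-index `M` with
`S₃⁵ ⊆ M ⊆ M₅` (e.g. every `γ_{c+1}(S₃)S₃⁵`, unbounded class) gen 2's `δ = δ(3,2)` is a symmetry of
the level-`M` shadow triple not congruent mod `M` to any automorphism stabilising `N₀`, `N₁`. [folklore] -/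
theorem unit_twist_tower (M : Subgroup S) [M.Characteristic] [M.FiniteIndex]
    (h5 : ∀ x : S, x ^ 5 ∈ M) (hle : M ≤ M5) :
    (∀ i : Fin 3, (s4Kernels i ⊔ M).map (MulEquiv.toMonoidHom (deltaT 3 2)) = s4Kernels i ⊔ M) ∧
      ¬ ∃ α : S ≃* S, (s4Kernels 0).map α.toMonoidHom = s4Kernels 0 ∧
        (s4Kernels 1).map α.toMonoidHom = s4Kernels 1 ∧ ∀ s, deltaT 3 2 s * (α s)⁻¹ ∈ M :=
  ⟨deltaT_level (t := 3) (t' := 2) (n := 5) (by norm_num) M h5,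
    not_lift_deltaT 5 3 2 (by decide) (by decide) M (hle.trans (M5_le_ker (chiQGen 5)))⟩

/-- For every modulus `n > 1` there are `t, t'` with `tt' ≡ 1 (mod n)` and `t' ≡ 2 (mod 5)`:
`t' = (ordCompl[5] n)⁴ + 1` is a unit mod `n`. [folklore] -/
theorem exists_unit_pair (n : ℕ) (hn : 1 < n) :
    ∃ t t' : ℤ, (n : ℤ) ∣ t * t' - 1 ∧ (t' : ZMod 5) = 2 := by
  have hn0 : n ≠ 0 := by omega
  have h5 : Nat.Prime 5 := by norm_num
  have hm5 : ¬ 5 ∣ ordCompl[5] n := Nat.not_dvd_ordCompl h5 hn0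
  set m : ℕ := ordCompl[5] n with hm
  have hcast : ((m ^ 4 + 1 : ℕ) : ZMod 5) = 2 := by
    haveI : Fact (Nat.Prime 5) := ⟨h5⟩
    have h : (m : ZMod 5) ≠ 0 := by rwa [Ne, ZMod.natCast_eq_zero_iff]
    push_cast
    rw [ZMod.pow_card_sub_one_eq_one h]
    rfl
  have hcop_m : Nat.Coprime (m ^ 4 + 1) m := by
    have h := (Nat.coprime_add_mul_right_right m 1 (m ^ 3)).2 (Nat.coprime_one_right m)
    rw [show 1 + m ^ 3 * m = m ^ 4 + 1 by ring] at h
    exact h.symm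
  have hcop_5 : Nat.Coprime (m ^ 4 + 1) 5 := by
    rw [Nat.coprime_comm, Nat.Prime.coprime_iff_not_dvd h5, ← ZMod.natCast_eq_zero_iff, hcast]
    decide
  have hcop : Nat.Coprime (m ^ 4 + 1) n := by
    rw [← Nat.ordProj_mul_ordCompl_eq_self n 5]
    exact Nat.Coprime.mul_right (hcop_5.pow_right _) hcop_m
  obtain ⟨t, -, ht⟩ := Nat.exists_mul_mod_eq_one_of_coprime hcop hn
  have hq : (m ^ 4 + 1) * t = n * ((m ^ 4 + 1) * t / n) + 1 := by
    have := Nat.div_add_mod ((m ^ 4 + 1) * t) n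
    rw [ht] at this
    omega
  refine ⟨t, (m ^ 4 + 1 : ℕ), ⟨(((m ^ 4 + 1) * t / n : ℕ) : ℤ), ?_⟩, by exact_mod_cast hcast⟩
  have := congrArg (Nat.cast : ℕ → ℤ) hq
  push_cast at this ⊢
  linarith

/-- **Units never die (II): cofinal failure of level-symmetry lifting.** Below EVERY characteristic
finite-index `M₀ ≤ S₃`, the level `M = M₀ ⊓ M₅` carries a symmetry `ψ = δ(t,t')` of the shadow triple
`(N₀M, N₁M, N₂M)` congruent mod `M` to NO automorphism stabilising `N₀`, `N₁` (`t' ≡ 2 (mod 5)` on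
`b₀`, `tt' ≡ 1` mod `[S₃:M]`). [folklore] -/
theorem levelSymmetriesLift_fails_cofinally (M₀ : Subgroup S) [h₀ : M₀.Characteristic]
    [M₀.FiniteIndex] :
    ∃ M : Subgroup S, M.Characteristic ∧ M.FiniteIndex ∧ M ≤ M₀ ∧
      ∃ ψ : S ≃* S, (∀ i : Fin 3, (s4Kernels i ⊔ M).map ψ.toMonoidHom = s4Kernels i ⊔ M) ∧
        ¬ ∃ α : S ≃* S, (s4Kernels 0).map α.toMonoidHom = s4Kernels 0 ∧
          (s4Kernels 1).map α.toMonoidHom = s4Kernels 1 ∧ ∀ s, ψ s * (α s)⁻¹ ∈ M := by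
  haveI hM : (M₀ ⊓ M5).Characteristic := by
    have h1 := Subgroup.characteristic_iff_comap_eq.1 h₀
    have h2 := Subgroup.characteristic_iff_comap_eq.1 M5_characteristic
    exact Subgroup.characteristic_iff_comap_eq.2 fun ϕ => by rw [Subgroup.comap_inf, h1 ϕ, h2 ϕ]
  have hlt : 1 < (M₀ ⊓ M5).index := by
    have h1 : (M₀ ⊓ M5).index ≠ 1 := by
      rw [Ne, Subgroup.index_eq_one]
      intro htop
      have hb : chiQ 5 (b 0) = 1 := (M5_le_ker (chiQGen 5)) ((inf_le_right : M₀ ⊓ M5 ≤ M5) (htop ▸ trivial))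
      rw [chiQ_b0] at hb
      exact absurd (congrArg Multiplicative.toAdd hb) (by decide)
    have h0 : (M₀ ⊓ M5).index ≠ 0 := Subgroup.index_ne_zero_of_finite
    omega
  obtain ⟨t, t', hn, ht'⟩ := exists_unit_pair _ hlt
  refine ⟨M₀ ⊓ M5, hM, inferInstance, inf_le_left, deltaT t t', ?_, ?_⟩
  · exact deltaT_level hn (M₀ ⊓ M5) (fun x => Subgroup.pow_index_mem _ x)
  · refine not_lift_deltaT 5 t t' ?_ ?_ (M₀ ⊓ M5) (inf_le_right.trans (M5_le_ker (chiQGen 5)))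
    · rw [ht']; decide
    · rw [ht']; decide

/-- **"EventualLevelSymmetriesLift" is false**: there is NO level `M₀` beyond which every symmetry of
the level-`M` shadow triple of the standard genus-3 trisection of `S⁴` is congruent mod `M` to a
symmetry of `(N₀, N₁)` — the units obstruction is not a shallow-level artefact. [folklore] -/
theorem not_eventualLevelSymmetriesLift :
    ¬ ∃ M₀ : Subgroup S, M₀.Characteristic ∧ M₀.FiniteIndex ∧
      ∀ M : Subgroup S, M.Characteristic → M.FiniteIndex → M ≤ M₀ →
        ∀ ψ : S ≃* S, (∀ i : Fin 3, (s4Kernels i ⊔ M).map ψ.toMonoidHom = s4Kernels i ⊔ M) →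
          ∃ α : S ≃* S, (s4Kernels 0).map α.toMonoidHom = s4Kernels 0 ∧
            (s4Kernels 1).map α.toMonoidHom = s4Kernels 1 ∧ ∀ s, ψ s * (α s)⁻¹ ∈ M := by
  rintro ⟨M₀, h₀, hF, h⟩
  haveI := h₀
  haveI := hF
  obtain ⟨M, hM, hMF, hle, ψ, hψ, hno⟩ := levelSymmetriesLift_fails_cofinally M₀
  exact hno (h M hM hMF hle ψ hψ)

end Summit.SmoothPoincare4.SmoothPoincare4.Theorems.ShadowApproximation.Negative

end
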